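import Literature.MathematicalPhysics.QuantumFieldTheory.BalabanImbrieJaffe1984to88.BIJ88Sect5StatementsPart4
import Literature.MathematicalPhysics.QuantumFieldTheory.BalabanImbrieJaffe1984to88.BIJ88Assoc575Zd

/-!
# `BalabanImbrieJaffe1984to88.BIJ88Ineq576Proof` — T. Bałaban, J. Imbrie, A. Jaffe, *Effective action and cluster
properties of the abelian Higgs model*, Commun. Math. Phys. **114** (1988) 257–315 [BalabanImbrieJaffe1988]:
**(5.7.6)** p. 290 PROVED — *"where compatible means that b₁, …, b_m, b were associated to X as above. We have
|A′(b_l)| ≤ cp(e_k), |w₅(b,b_l)| ≤ e^{−cr(e_k)}e^{−c dist(b,b_l)} and so |w_{b,m}(X)| ≤ e^{−cr(e_k)|X|}. (5.7.6)"* — for the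
CONCRETE localized powers `w_{b,m}(X)` = `BIJ88Sect5StatementsPart4.wbm` of (5.7.5) with the `ℤ^d` association
`BIJ88Assoc575Zd.assocZd` (kind «model-instance»: the typed leaf `BIJ88Sect5StatementsPart2.Ineq576` quantifies over an
abstract polymer system and an abstract `w`; it is proved here for `⟨Finset (ℤ^d), card⟩` and `wbm w₅ A′ b m (assocZd pos ℓ b m)`).

statement-level skeleton of published theorems with citation tags; proofs where landed; nothing here is a claim about the Yang–Mills mass gap

PDF held: `paper:balaban1988-cmp114-bij-abelian-higgs-effective-action` (journal page = PDF page + 256).  Pages read as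
images: PDF pp. 33–34 (journal 289–290), `g4png.py` ×2 renders.

CITATION HEADER (lean-in-tree rule).  Part of the lit-balaban TYPED SKELETON (HOME `run/shared/lean/pub/lit-balaban/`),
Phase 2, seat p36 (gen 3, unit `lit-balaban-p36`); file 2/2 for row **C2.Eq5.7.6** of `HOME/lit-balaban-r16/ROWS-C2-part2.md`
(leaf typed p240155 by r16; `wbm` typed p245624 by r16; association + lattice geometry = file 1/2 `BIJ88Assoc575Zd`).
WHAT IS REPRODUCED, and how — the printed one-line proof made quantitative, every constant explicit (ROWS-NORMS T-rules:
no fresh `∃`), theorem-only file: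
* §1 THE PRINTED ARGUMENT for ANY finite bond type and ANY association that is TIGHT for the polymer `X`
  (`Δ ≤ Σ_l D(b_l)` on the fibre of `X`): per tuple `Π_l |w(b,b_l)||A′(b_l)| ≤ Π_l aWe^{−cD(b_l)}`, half of the decay pays for
  `|X|` through tightness, the other half is summed over ALL tuples, `Σ_t Π_l e^{−(c/2)D(t_l)} = (Σ_{b′} e^{−(c/2)D(b′)})^m ≤ S^m`:
  `abs_wbm_le_of_tight : |w_{b,m}(X)| ≤ e^{−(c/2)Δ}·(aWS)^m`.
* §2 the LATTICE SUM behind *"and so"*: `Σ_{y ∈ T} e^{−c·supDist(x,y)} ≤ (1 + 2d/c)^d` for every finite `T ⊂ ℤ^d`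
  (`sum_exp_neg_supDist_le`; box enclosure + `Finset.prod_univ_sum` + the geometric series over `ℤ`, as in
  `Balaban1983to89.B10Eq45LatticeSum` for `ℤ³`), hence `≤ N(1 + 2d/c)^d` over bonds with at most `N` per site
  (`sum_exp_neg_supDist_fiber_le`).
* §3 **(5.7.6) for the `ℤ^d` association** (cube side `ℓ = r(e_k)` lattice units, sup-norm distances, `c₃ = min(c₁/2, c₂)`):
  from `|w₅(b,b′)| ≤ e^{−c₁ℓ}e^{−c₂·dist(b,b′)}`, `|A′| ≤ a`, `Σ_{b′}e^{−(c₃/2)dist(b,b′)} ≤ S` and `r(e_k)` LARGE in the precise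
  sense `aS ≤ e^{c₁ℓ/4}` (the print's «|A′| ≤ cp(e_k)» logarithmic growth is beaten by `e^{−cr(e_k)}`), for every `m ≥ 1`:
  `ineq576_of_latticeSum : Ineq576 ⟨Finset ℤ^d, card⟩ (wbm w₅ A′ b m (assocZd pos ℓ b m)) c′ ℓ` with
  **`c′ = min(c₁/4, c₃/(2d))`**; and with the lattice sum DISCHARGED for bonds with at most `N` per site
  (`sum_exp_neg_supDist_fiber_le`, `S = N(1 + 4d/c₃)^d`): `ineq576_Zd`.  Also `ineq576_mono_rk`: the bound
  with cube side `ℓ` implies it for every `0 ≤ r(e_k) ≤ ℓ` (real `r(e_k)`, cubes of side `⌈r(e_k)⌉`).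
READING NOTE (recorded, not adjudicated; also in file 1/2 and `HOME/lit-balaban-r16` INBOX): the print associates `X` *"in
some arbitrary manner"*; (5.7.6) is false for a literally arbitrary association and holds for every tight one — ours is
tight with `ℓ(|X| − 1) ≤ d·Σ_l dist(b,b_l) + 2d·m·ℓ` (`BIJ88Assoc575Zd.tight_assocZd`).  The case `m = 0` is excluded (the
powers in `F_{1,j}` start at `n ≥ 1`; for `m = 0`, `w_{b,0}(cube(b)) = 1`).  NOT here: the identification of `w₅` with the
kernel of (5.4.9) and of `a` with `cp(e_k)` (they enter as the two displayed hypotheses, exactly as in print); no new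
`Prop` facts; axioms standard.
-/

namespace Literature.MathematicalPhysics.QuantumFieldTheory.BalabanImbrieJaffe1984to88.BIJ88Ineq576Proof

open Finset
open BIJ88Sect5StatementsPart2 BIJ88Sect5StatementsPart4 BIJ88WalkGeometryZd BIJ88Assoc575Zd

/-! ## §1 The printed estimate for any tight association -/

section Core

variable {β ξ : Type*} [Fintype β] [DecidableEq ξ]

/-- triangle inequality on (5.7.5): `|w_{b,m}(X)| ≤ Σ_{(b₁…b_m) compatible with b,X} Π_l |w(b,b_l)|·|A′(b_l)|`.
[cite: BalabanImbrieJaffe1988, (5.7.6) p.290] -/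
theorem abs_wbm_le (w : β → β → ℝ) (A' : β → ℝ) (b : β) (m : ℕ) (assoc : (Fin m → β) → ξ) (X : ξ) :
    |wbm w A' b m assoc X| ≤
      ∑ t ∈ (Finset.univ : Finset (Fin m → β)).filter (fun t => assoc t = X), ∏ l, |w b (t l)| * |A' (t l)| := by
  unfold wbm
  refine (Finset.abs_sum_le_sum_abs _ _).trans (le_of_eq (Finset.sum_congr rfl fun t _ => ?_))
  rw [Finset.abs_prod]
  exact Finset.prod_congr rfl fun l _ => abs_mul _ _

/-- the sum over ALL `m`-tuples of a product factorizes: `Σ_t Π_l g(t_l) = (Σ_{b′} g(b′))^m`.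
[cite: BalabanImbrieJaffe1988, (5.7.5) p.289] -/
theorem sum_tuples_prod_eq_pow (g : β → ℝ) (m : ℕ) : ∑ t : Fin m → β, ∏ l, g (t l) = (∑ b', g b') ^ m := by
  rw [← Fintype.prod_sum fun (_ : Fin m) (b' : β) => g b']
  simp

/-- **THE PRINTED ONE-LINE ARGUMENT** (p. 290), for any association `assoc` and a polymer `X` on whose fibre the total
distance is bounded below (`Δ ≤ Σ_l D(b_l)` whenever `(b₁,…,b_m)` is compatible with `b, X` — TIGHTNESS): if
`|w(b,b′)| ≤ W·e^{−cD(b′)}`, `|A′(b′)| ≤ a` and `Σ_{b′} e^{−(c/2)D(b′)} ≤ S`, then `|w_{b,m}(X)| ≤ e^{−(c/2)Δ}·(aWS)^m` — half of the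
decay pays for `Δ`, the other half is summed over all tuples. [cite: BalabanImbrieJaffe1988, (5.7.6) p.290] -/
theorem abs_wbm_le_of_tight (w : β → β → ℝ) (A' : β → ℝ) (b : β) (m : ℕ) (assoc : (Fin m → β) → ξ) (X : ξ)
    {D : β → ℝ} {W a c S Δ : ℝ} (hW : 0 ≤ W) (hc : 0 ≤ c)
    (hw : ∀ b', |w b b'| ≤ W * Real.exp (-(c * D b'))) (hA : ∀ b', |A' b'| ≤ a)
    (hS : ∑ b', Real.exp (-(c / 2 * D b')) ≤ S)
    (htight : ∀ t : Fin m → β, assoc t = X → Δ ≤ ∑ l, D (t l)) :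
    |wbm w A' b m assoc X| ≤ Real.exp (-(c / 2 * Δ)) * (a * W * S) ^ m := by
  classical
  have ha : 0 ≤ a := (abs_nonneg _).trans (hA b)
  -- per-tuple bound
  have hterm : ∀ t ∈ (Finset.univ : Finset (Fin m → β)).filter (fun t => assoc t = X),
      ∏ l, |w b (t l)| * |A' (t l)| ≤
        Real.exp (-(c / 2 * Δ)) * ((a * W) ^ m * ∏ l, Real.exp (-(c / 2 * D (t l)))) := by
    intro t ht
    have hX : assoc t = X := (Finset.mem_filter.mp ht).2
    have hΔ : Δ ≤ ∑ l, D (t l) := htight t hX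
    calc ∏ l, |w b (t l)| * |A' (t l)|
        ≤ ∏ l, (a * W * Real.exp (-(c * D (t l)))) := by
          apply Finset.prod_le_prod
          · intro l _; positivity
          · intro l _
            calc |w b (t l)| * |A' (t l)| ≤ (W * Real.exp (-(c * D (t l)))) * a :=
                  mul_le_mul (hw _) (hA _) (abs_nonneg _) (by positivity)
              _ = a * W * Real.exp (-(c * D (t l))) := by ring
      _ = (a * W) ^ m * Real.exp (-(c * ∑ l, D (t l))) := by
          rw [Finset.prod_mul_distrib, Finset.prod_const, Finset.card_univ, Fintype.card_fin, ← Real.exp_sum]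
          congr 1
          rw [Finset.mul_sum, ← Finset.sum_neg_distrib]
      _ ≤ (a * W) ^ m * (Real.exp (-(c / 2 * Δ)) * Real.exp (-(c / 2 * ∑ l, D (t l)))) := by
          apply mul_le_mul_of_nonneg_left _ (by positivity)
          rw [← Real.exp_add, Real.exp_le_exp]
          nlinarith
      _ = Real.exp (-(c / 2 * Δ)) * ((a * W) ^ m * ∏ l, Real.exp (-(c / 2 * D (t l)))) := by
          rw [← Real.exp_sum, Finset.mul_sum, ← Finset.sum_neg_distrib]
          ring
  have hsum_nonneg : 0 ≤ ∑ b', Real.exp (-(c / 2 * D b')) := Finset.sum_nonneg fun _ _ => (Real.exp_pos _).le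
  calc |wbm w A' b m assoc X|
      ≤ ∑ t ∈ (Finset.univ : Finset (Fin m → β)).filter (fun t => assoc t = X), ∏ l, |w b (t l)| * |A' (t l)| :=
        abs_wbm_le w A' b m assoc X
    _ ≤ ∑ t ∈ (Finset.univ : Finset (Fin m → β)).filter (fun t => assoc t = X),
          Real.exp (-(c / 2 * Δ)) * ((a * W) ^ m * ∏ l, Real.exp (-(c / 2 * D (t l)))) := Finset.sum_le_sum hterm
    _ ≤ ∑ t : Fin m → β, Real.exp (-(c / 2 * Δ)) * ((a * W) ^ m * ∏ l, Real.exp (-(c / 2 * D (t l)))) :=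
        Finset.sum_le_sum_of_subset_of_nonneg (Finset.filter_subset _ _) fun t _ _ => by positivity
    _ = Real.exp (-(c / 2 * Δ)) * ((a * W) ^ m * (∑ b', Real.exp (-(c / 2 * D b'))) ^ m) := by
        rw [← Finset.mul_sum, ← Finset.mul_sum, sum_tuples_prod_eq_pow (fun x => Real.exp (-(c / 2 * D x))) m]
    _ ≤ Real.exp (-(c / 2 * Δ)) * ((a * W) ^ m * S ^ m) := by
        gcongr
    _ = Real.exp (-(c / 2 * Δ)) * (a * W * S) ^ m := by ring

end Core

/-! ## §2 The lattice sum behind *"and so"* (p. 290): `Σ_{b′} e^{−c·dist(b,b′)} ≤ N(1 + 2d/c)^d` -/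

section LatticeSum

variable {dd : ℕ} {β : Type*}


/-- `Σ_{m ∈ ℤ} e^{−b|m|} = (1 + e^{−b})/(1 − e^{−b})` for `b > 0` (summability and value; two geometric series — as in
`Balaban1983to89.B10Eq45LatticeSum`). [folklore] -/
private theorem tsum_int_exp_neg_mul_abs {b : ℝ} (hb : 0 < b) :
    Summable (fun m : ℤ => Real.exp (-(b * |(m : ℝ)|))) ∧
      ∑' m : ℤ, Real.exp (-(b * |(m : ℝ)|)) = (1 + Real.exp (-b)) / (1 - Real.exp (-b)) := by
  have hr : Real.exp (-b) < 1 := by rw [Real.exp_lt_one_iff]; linarith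
  have hr0 : 0 ≤ Real.exp (-b) := (Real.exp_pos _).le
  have hnat_eq : (fun n : ℕ => Real.exp (-(b * |((n : ℤ) : ℝ)|))) = fun n : ℕ => Real.exp (-b) ^ n := by
    funext n
    rw [← Real.exp_nat_mul]; congr 1
    rw [Int.cast_natCast, abs_of_nonneg (Nat.cast_nonneg n)]; ring
  have hneg_eq : (fun n : ℕ => Real.exp (-(b * |((-((n : ℤ) + 1) : ℤ) : ℝ)|)))
      = fun n : ℕ => Real.exp (-b) * Real.exp (-b) ^ n := by
    funext n
    rw [← pow_succ', ← Real.exp_nat_mul]; congr 1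
    have hc : ((-((n : ℤ) + 1) : ℤ) : ℝ) = -((n : ℝ) + 1) := by push_cast; ring
    rw [hc, abs_neg, abs_of_nonneg (by positivity)]; push_cast; ring
  have hnat : Summable fun n : ℕ => Real.exp (-(b * |((n : ℤ) : ℝ)|)) := by
    rw [hnat_eq]; exact summable_geometric_of_lt_one hr0 hr
  have hneg : Summable fun n : ℕ => Real.exp (-(b * |((-((n : ℤ) + 1) : ℤ) : ℝ)|)) := by
    rw [hneg_eq]; exact (summable_geometric_of_lt_one hr0 hr).mul_left _
  have h1 : ∑' n : ℕ, Real.exp (-(b * |((n : ℤ) : ℝ)|)) = (1 - Real.exp (-b))⁻¹ := by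
    rw [hnat_eq]; exact tsum_geometric_of_lt_one hr0 hr
  have h2 : ∑' n : ℕ, Real.exp (-(b * |((-((n : ℤ) + 1) : ℤ) : ℝ)|))
      = Real.exp (-b) * (1 - Real.exp (-b))⁻¹ := by
    rw [hneg_eq, tsum_mul_left, tsum_geometric_of_lt_one hr0 hr]
  refine ⟨Summable.of_nat_of_neg_add_one (f := fun z : ℤ => Real.exp (-(b * |(z : ℝ)|))) hnat hneg, ?_⟩
  rw [tsum_of_nat_of_neg_add_one (f := fun z : ℤ => Real.exp (-(b * |(z : ℝ)|))) hnat hneg, h1, h2]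
  have hne : 1 - Real.exp (-b) ≠ 0 := by linarith
  field_simp

/-- one-dimensional factor: `Σ_{n ∈ [x−R, x+R]} e^{−b|n − x|} ≤ Σ_{m ∈ ℤ} e^{−b|m|} ≤ 1 + 2/b` (as in
`Balaban1983to89.B10Eq45LatticeSum`). [folklore] -/
private theorem sum_Icc_exp_le {b : ℝ} (hb : 0 < b) (x : ℤ) (R : ℕ) :
    ∑ n ∈ Finset.Icc (x - R) (x + R), Real.exp (-(b * |((n - x : ℤ) : ℝ)|)) ≤ 1 + 2 / b := by
  obtain ⟨hS, hval0⟩ := tsum_int_exp_neg_mul_abs hb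
  set f : ℤ → ℝ := fun m => Real.exp (-(b * |(m : ℝ)|)) with hf
  have hshift : ∑ n ∈ Finset.Icc (x - R) (x + R), f (n - x) ≤ ∑' m : ℤ, f m := by
    have hS' : Summable (fun n : ℤ => f (n - x)) := (Equiv.subRight x).summable_iff.mpr hS
    calc ∑ n ∈ Finset.Icc (x - R) (x + R), f (n - x) ≤ ∑' n : ℤ, f (n - x) :=
          hS'.sum_le_tsum _ (fun n _ => (Real.exp_pos _).le)
      _ = ∑' m : ℤ, f m := (Equiv.subRight x).tsum_eq f
  have htail : Real.exp (-b) / (1 - Real.exp (-b)) ≤ 1 / b := by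
    have hr1 : Real.exp (-b) < 1 := Real.exp_lt_one_iff.mpr (by linarith)
    have h : Real.exp (-b) * (b + 1) ≤ 1 := by
      calc Real.exp (-b) * (b + 1) ≤ Real.exp (-b) * Real.exp b :=
            mul_le_mul_of_nonneg_left (by linarith [Real.add_one_le_exp b]) (Real.exp_pos _).le
        _ = 1 := by rw [← Real.exp_add]; simp
    rw [div_le_div_iff₀ (by linarith) hb]
    nlinarith [h, Real.exp_pos (-b)]
  have hval : (1 + Real.exp (-b)) / (1 - Real.exp (-b)) = 1 + 2 * (Real.exp (-b) / (1 - Real.exp (-b))) := by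
    have hr1 : Real.exp (-b) < 1 := Real.exp_lt_one_iff.mpr (by linarith)
    have hne : 1 - Real.exp (-b) ≠ 0 := by linarith
    field_simp
    ring
  calc ∑ n ∈ Finset.Icc (x - R) (x + R), Real.exp (-(b * |((n - x : ℤ) : ℝ)|))
      = ∑ n ∈ Finset.Icc (x - R) (x + R), f (n - x) := rfl
    _ ≤ ∑' m : ℤ, f m := hshift
    _ = (1 + Real.exp (-b)) / (1 - Real.exp (-b)) := hval0
    _ = 1 + 2 * (Real.exp (-b) / (1 - Real.exp (-b))) := hval
    _ ≤ 1 + 2 * (1 / b) := by linarith [htail]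
    _ = 1 + 2 / b := by ring

/-- the sup-distance dominates the mean coordinate distance: `Σ_μ |x_μ − y_μ| ≤ d · supDist x y`.
[cite: BalabanImbrieJaffe1988, (5.7.6) p.290] -/
theorem sum_natAbs_le_mul_supDist (x y : Fin dd → ℤ) :
    ∑ μ, (((x μ - y μ).natAbs : ℕ) : ℝ) ≤ dd * supDist x y := by
  calc ∑ μ, (((x μ - y μ).natAbs : ℕ) : ℝ) ≤ ∑ _μ : Fin dd, supDist x y :=
        Finset.sum_le_sum fun μ _ => natAbs_le_supDist x y μ
    _ = dd * supDist x y := by rw [Finset.sum_const, Finset.card_univ, Fintype.card_fin, nsmul_eq_mul]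

/-- **THE LATTICE SUM** (sup-norm decay): `Σ_{y ∈ T} e^{−c·supDist(x,y)} ≤ (1 + 2d/c)^d` for every finite `T ⊂ ℤ^d`, `d ≥ 1`
(enclose `T` in a box around `x`; `e^{−c·sup} ≤ Π_μ e^{−(c/d)|x_μ − y_μ|}`; the box sum factorizes). [cite: BalabanImbrieJaffe1988, (5.7.6) p.290] -/
theorem sum_exp_neg_supDist_le (hd : 0 < dd) {c : ℝ} (hc : 0 < c) (x : Fin dd → ℤ) (T : Finset (Fin dd → ℤ)) :
    ∑ y ∈ T, Real.exp (-(c * supDist x y)) ≤ (1 + 2 * dd / c) ^ dd := by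
  classical
  have hdpos : (0 : ℝ) < dd := by exact_mod_cast hd
  set b : ℝ := c / dd with hbdef
  have hb : 0 < b := div_pos hc hdpos
  -- a box around x containing T
  set R : ℕ := T.sup fun y => Finset.univ.sup fun μ => (y μ - x μ).natAbs with hR
  set box : Finset (Fin dd → ℤ) := Fintype.piFinset fun μ => Finset.Icc (x μ - R) (x μ + R) with hbox
  have hsub : T ⊆ box := by
    intro y hy
    rw [hbox, Fintype.mem_piFinset]
    intro μ
    have hμ : (y μ - x μ).natAbs ≤ R := by
      rw [hR]
      exact le_trans (Finset.le_sup (f := fun μ => (y μ - x μ).natAbs) (Finset.mem_univ μ))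
        (Finset.le_sup (f := fun y => Finset.univ.sup fun μ => (y μ - x μ).natAbs) hy)
    rw [Finset.mem_Icc]
    constructor <;> omega
  -- pointwise: e^{-c sup} ≤ Π_μ e^{-b |y_μ - x_μ|}
  have hterm : ∀ y : Fin dd → ℤ, Real.exp (-(c * supDist x y)) ≤
      ∏ μ, Real.exp (-(b * |((y μ - x μ : ℤ) : ℝ)|)) := by
    intro y
    have h1 : ∑ μ, b * |((y μ - x μ : ℤ) : ℝ)| ≤ c * supDist x y := by
      rw [← Finset.mul_sum]
      have h2 : ∑ μ, |((y μ - x μ : ℤ) : ℝ)| = ∑ μ, (((x μ - y μ).natAbs : ℕ) : ℝ) := by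
        refine Finset.sum_congr rfl fun μ _ => ?_
        rw [Nat.cast_natAbs, Int.cast_abs, Int.cast_sub, Int.cast_sub, abs_sub_comm]
      rw [h2, hbdef]
      have h3 := sum_natAbs_le_mul_supDist x y
      calc c / dd * ∑ μ, (((x μ - y μ).natAbs : ℕ) : ℝ) ≤ c / dd * (dd * supDist x y) :=
            mul_le_mul_of_nonneg_left h3 (div_pos hc hdpos).le
        _ = c * supDist x y := by field_simp
    rw [← Real.exp_sum, Real.exp_le_exp, Finset.sum_neg_distrib]
    exact neg_le_neg h1
  calc ∑ y ∈ T, Real.exp (-(c * supDist x y))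
      ≤ ∑ y ∈ box, Real.exp (-(c * supDist x y)) :=
        Finset.sum_le_sum_of_subset_of_nonneg hsub fun y _ _ => (Real.exp_pos _).le
    _ ≤ ∑ y ∈ box, ∏ μ, Real.exp (-(b * |((y μ - x μ : ℤ) : ℝ)|)) := Finset.sum_le_sum fun y _ => hterm y
    _ = ∏ μ : Fin dd, ∑ n ∈ Finset.Icc (x μ - R) (x μ + R), Real.exp (-(b * |((n - x μ : ℤ) : ℝ)|)) := by
        rw [hbox, Finset.prod_univ_sum]
    _ ≤ ∏ _μ : Fin dd, (1 + 2 / b) := by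
        apply Finset.prod_le_prod
        · intro μ _; exact Finset.sum_nonneg fun n _ => (Real.exp_pos _).le
        · intro μ _; exact sum_Icc_exp_le hb (x μ) R
    _ = (1 + 2 * dd / c) ^ dd := by
        rw [Finset.prod_const, Finset.card_univ, Fintype.card_fin, hbdef]
        congr 1
        field_simp

/-- **BONDS INSTEAD OF SITES**: for bonds placed in `ℤ^d` by `pos` with at most `N` bonds per site,
`Σ_{b′} e^{−c·supDist(pos b, pos b′)} ≤ N(1 + 2d/c)^d` (fibrewise, `Finset.sum_comp`). [cite: BalabanImbrieJaffe1988, (5.7.6) p.290] -/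
theorem sum_exp_neg_supDist_fiber_le [Fintype β] [DecidableEq β] (hd : 0 < dd) (pos : β → Fin dd → ℤ) (N : ℕ)
    (hN : ∀ y, (Finset.univ.filter fun b' => pos b' = y).card ≤ N) {c : ℝ} (hc : 0 < c) (b : β) :
    ∑ b', Real.exp (-(c * supDist (pos b) (pos b'))) ≤ N * (1 + 2 * dd / c) ^ dd := by
  classical
  rw [Finset.sum_comp (s := Finset.univ) (f := fun y => Real.exp (-(c * supDist (pos b) y))) (g := pos)]
  calc ∑ y ∈ Finset.univ.image pos, (Finset.univ.filter fun b' => pos b' = y).card • Real.exp (-(c * supDist (pos b) y))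
      ≤ ∑ y ∈ Finset.univ.image pos, (N : ℝ) * Real.exp (-(c * supDist (pos b) y)) := by
        refine Finset.sum_le_sum fun y _ => ?_
        rw [nsmul_eq_mul]
        exact mul_le_mul_of_nonneg_right (by exact_mod_cast hN y) (Real.exp_pos _).le
    _ = N * ∑ y ∈ Finset.univ.image pos, Real.exp (-(c * supDist (pos b) y)) := by rw [Finset.mul_sum]
    _ ≤ N * (1 + 2 * dd / c) ^ dd :=
        mul_le_mul_of_nonneg_left (sum_exp_neg_supDist_le hd hc (pos b) _) (Nat.cast_nonneg N)

end LatticeSum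

/-! ## §3 (5.7.6) for the `ℤ^d` association -/

section Zd

variable {dd : ℕ} {β : Type*} [Fintype β]

/-- the fibres of the `ℤ^d` association are never the empty polymer: `w_{b,m}(∅) = 0`.
[cite: BalabanImbrieJaffe1988, (5.7.5) p.289] -/
theorem wbm_assocZd_empty (pos : β → Fin dd → ℤ) (ℓ : ℕ) (w : β → β → ℝ) (A' : β → ℝ) (b : β) (m : ℕ) :
    wbm w A' b m (assocZd pos ℓ b m) ∅ = 0 := by
  classical
  unfold wbm
  refine Finset.sum_eq_zero fun t ht => ?_
  exact absurd (Finset.mem_filter.mp ht).2 (assocZd_ne_empty pos ℓ b m t)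

/-- **(5.7.6) for the `ℤ^d` association, lattice sum as a hypothesis** (the print's one-liner with explicit constants):
bonds placed in `ℤ^d` by `pos`, `r(e_k)`-cubes of side `ℓ ≥ 1`, `|w₅(b,b′)| ≤ e^{−c₁ℓ}e^{−c₂·supDist(b,b′)}`, `|A′(b′)| ≤ a`,
`Σ_{b′} e^{−(c₃/2)·supDist(b,b′)} ≤ S` with `c₃ = min(c₁/2, c₂)`, and `r(e_k)` large: `aS ≤ e^{c₁ℓ/4}`.  Then for every
`m ≥ 1`, `|w_{b,m}(X)| ≤ e^{−c′ℓ|X|}` for ALL polymers `X`, `c′ = min(c₁/4, c₃/(2d))`.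
[cite: BalabanImbrieJaffe1988, (5.7.6) p.290] -/
theorem ineq576_of_latticeSum (hd : 0 < dd) (pos : β → Fin dd → ℤ) {ℓ : ℕ} (hℓ : 0 < ℓ) (w : β → β → ℝ)
    (A' : β → ℝ) (b : β) {m : ℕ} (hm : 1 ≤ m) {c₁ c₂ a S : ℝ} (hc₁ : 0 < c₁) (hc₂ : 0 < c₂)
    (hw : ∀ b', |w b b'| ≤ Real.exp (-(c₁ * ℓ)) * Real.exp (-(c₂ * supDist (pos b) (pos b'))))
    (hA : ∀ b', |A' b'| ≤ a)
    (hS : ∑ b', Real.exp (-(min (c₁ / 2) c₂ / 2 * supDist (pos b) (pos b'))) ≤ S)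
    (hlarge : a * S ≤ Real.exp (c₁ * ℓ / 4)) :
    Ineq576 ⟨Finset (Fin dd → ℤ), Finset.card⟩ (wbm w A' b m (assocZd pos ℓ b m))
      (min (c₁ / 4) (min (c₁ / 2) c₂ / (2 * dd))) ℓ := by
  classical
  intro X
  set c₃ : ℝ := min (c₁ / 2) c₂ with hc₃def
  have hc₃pos : 0 < c₃ := lt_min (by linarith) hc₂
  have hc₃c₁ : c₃ ≤ c₁ / 2 := min_le_left _ _
  have hc₃c₂ : c₃ ≤ c₂ := min_le_right _ _
  have hdpos : (0 : ℝ) < dd := by exact_mod_cast hd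
  have hℓpos : (0 : ℝ) < ℓ := by exact_mod_cast hℓ
  have ha : 0 ≤ a := (abs_nonneg _).trans (hA b)
  -- the empty polymer
  by_cases hX : X = ∅
  · subst hX
    show |wbm w A' b m (assocZd pos ℓ b m) ∅| ≤ _
    rw [wbm_assocZd_empty, abs_zero]
    exact (Real.exp_pos _).le
  have hcard : (1 : ℝ) ≤ (X.card : ℝ) := by
    exact_mod_cast Finset.card_pos.mpr (Finset.nonempty_iff_ne_empty.mpr hX)
  -- the kernel bound with the weaker rate c₃ ≤ c₂
  have hw' : ∀ b', |w b b'| ≤ Real.exp (-(c₁ * ℓ)) * Real.exp (-(c₃ * supDist (pos b) (pos b'))) := by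
    intro b'
    refine (hw b').trans (mul_le_mul_of_nonneg_left ?_ (Real.exp_pos _).le)
    exact Real.exp_le_exp.mpr (neg_le_neg (mul_le_mul_of_nonneg_right hc₃c₂ (supDist_nonneg _ _)))
  -- tightness of the association, as a lower bound on the total distance on the fibre of X
  have htight : ∀ t : Fin m → β, assocZd pos ℓ b m t = X →
      (ℓ / dd * ((X.card : ℝ) - 1) - 2 * m * ℓ) ≤ ∑ l, supDist (pos b) (pos (t l)) := by
    intro t ht
    have h := tight_assocZd pos hℓ b m t
    rw [ht] at h
    rw [div_mul_eq_mul_div, sub_le_iff_le_add, div_le_iff₀ hdpos]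
    nlinarith
  -- the printed argument
  have hcore := abs_wbm_le_of_tight w A' b m (assocZd pos ℓ b m) X (Real.exp_pos _).le hc₃pos.le hw' hA hS htight
  -- arithmetic: e^{-(c₃/2)(ℓ/d (|X|-1) - 2mℓ)} (a e^{-c₁ℓ} S)^m ≤ e^{-c′ ℓ |X|}
  refine hcore.trans ?_
  show Real.exp (-(c₃ / 2 * (ℓ / dd * ((X.card : ℝ) - 1) - 2 * m * ℓ))) * (a * Real.exp (-(c₁ * ℓ)) * S) ^ m
    ≤ Real.exp (-(min (c₁ / 4) (c₃ / (2 * dd)) * ℓ) * (X.card : ℝ))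
  have hm' : (1 : ℝ) ≤ m := by exact_mod_cast hm
  -- (a e^{-c₁ℓ} S)^m ≤ e^{-(3/4) c₁ ℓ m}
  have hbase : a * Real.exp (-(c₁ * ℓ)) * S ≤ Real.exp (-(3 / 4 * c₁ * ℓ)) := by
    have h1 : a * Real.exp (-(c₁ * ℓ)) * S = (a * S) * Real.exp (-(c₁ * ℓ)) := by ring
    rw [h1]
    calc a * S * Real.exp (-(c₁ * ℓ)) ≤ Real.exp (c₁ * ℓ / 4) * Real.exp (-(c₁ * ℓ)) :=
          mul_le_mul_of_nonneg_right hlarge (Real.exp_pos _).le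
      _ = Real.exp (-(3 / 4 * c₁ * ℓ)) := by rw [← Real.exp_add]; congr 1; ring
  have hbase0 : 0 ≤ a * Real.exp (-(c₁ * ℓ)) * S := by
    have hS0 : 0 ≤ S := le_trans (Finset.sum_nonneg fun _ _ => (Real.exp_pos _).le) hS
    positivity
  have hpow : (a * Real.exp (-(c₁ * ℓ)) * S) ^ m ≤ Real.exp (-(3 / 4 * c₁ * ℓ * m)) := by
    calc (a * Real.exp (-(c₁ * ℓ)) * S) ^ m ≤ Real.exp (-(3 / 4 * c₁ * ℓ)) ^ m :=
          pow_le_pow_left₀ hbase0 hbase m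
      _ = Real.exp (-(3 / 4 * c₁ * ℓ * m)) := by rw [← Real.exp_nat_mul]; congr 1; ring
  calc Real.exp (-(c₃ / 2 * (ℓ / dd * ((X.card : ℝ) - 1) - 2 * m * ℓ))) * (a * Real.exp (-(c₁ * ℓ)) * S) ^ m
      ≤ Real.exp (-(c₃ / 2 * (ℓ / dd * ((X.card : ℝ) - 1) - 2 * m * ℓ))) * Real.exp (-(3 / 4 * c₁ * ℓ * m)) :=
        mul_le_mul_of_nonneg_left hpow (Real.exp_pos _).le
    _ ≤ Real.exp (-(min (c₁ / 4) (c₃ / (2 * dd)) * ℓ) * (X.card : ℝ)) := by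
        rw [← Real.exp_add, Real.exp_le_exp]
        set A : ℝ := c₃ / (2 * dd) * ℓ * ((X.card : ℝ) - 1) with hAdef
        have hmin1 : min (c₁ / 4) (c₃ / (2 * dd)) ≤ c₁ / 4 := min_le_left _ _
        have hmin2 : min (c₁ / 4) (c₃ / (2 * dd)) ≤ c₃ / (2 * dd) := min_le_right _ _
        -- c′ℓ|X| ≤ A + (c₁/4)ℓ
        have hkey : min (c₁ / 4) (c₃ / (2 * dd)) * ℓ * (X.card : ℝ) ≤ A + c₁ / 4 * ℓ := by
          have h1 : min (c₁ / 4) (c₃ / (2 * dd)) * ℓ * ((X.card : ℝ) - 1) ≤ c₃ / (2 * dd) * ℓ * ((X.card : ℝ) - 1) :=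
            mul_le_mul_of_nonneg_right (mul_le_mul_of_nonneg_right hmin2 hℓpos.le) (by linarith)
          have h2 : min (c₁ / 4) (c₃ / (2 * dd)) * ℓ ≤ c₁ / 4 * ℓ := mul_le_mul_of_nonneg_right hmin1 hℓpos.le
          have h3 : min (c₁ / 4) (c₃ / (2 * dd)) * ℓ * (X.card : ℝ)
              = min (c₁ / 4) (c₃ / (2 * dd)) * ℓ * ((X.card : ℝ) - 1) + min (c₁ / 4) (c₃ / (2 * dd)) * ℓ := by ring
          rw [h3, hAdef]
          linarith
        -- the exponent of the tightness factor, split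
        have hexp : c₃ / 2 * (ℓ / dd * ((X.card : ℝ) - 1) - 2 * m * ℓ) = A - c₃ * (m * ℓ) := by
          rw [hAdef]
          field_simp
        -- c₃ m ℓ ≤ (c₁/2) m ℓ and c₁ ℓ ≤ c₁ ℓ m
        have h5 : c₃ * (m * ℓ) ≤ c₁ / 2 * (m * ℓ) := mul_le_mul_of_nonneg_right hc₃c₁ (by positivity)
        have hcm : c₁ * ℓ ≤ c₁ * (m * ℓ) := by
          have : c₁ * ℓ * 1 ≤ c₁ * ℓ * m := mul_le_mul_of_nonneg_left hm' (by positivity)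
          linarith
        rw [hexp]
        linarith

/-- **(5.7.6) on `ℤ^d`, every geometric hypothesis discharged**: as `ineq576_of_latticeSum`, with the lattice sum evaluated
for bonds with at most `N` per site (`S = N(1 + 4d/c₃)^d`, `sum_exp_neg_supDist_fiber_le`); the hypotheses
left are exactly the two displayed on p. 290 (`|A′(b_l)| ≤ a`, `|w₅(b,b_l)| ≤ e^{−c₁r}e^{−c₂dist(b,b_l)}`) and `r(e_k)` large
(`a·N(1 + 4d/c₃)^d ≤ e^{c₁r/4}`). [cite: BalabanImbrieJaffe1988, (5.7.6) p.290] -/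
theorem ineq576_Zd [DecidableEq β] (hd : 0 < dd) (pos : β → Fin dd → ℤ) (N : ℕ)
    (hN : ∀ y, (Finset.univ.filter fun b' => pos b' = y).card ≤ N) {ℓ : ℕ} (hℓ : 0 < ℓ) (w : β → β → ℝ)
    (A' : β → ℝ) (b : β) {m : ℕ} (hm : 1 ≤ m) {c₁ c₂ a : ℝ} (hc₁ : 0 < c₁) (hc₂ : 0 < c₂)
    (hw : ∀ b', |w b b'| ≤ Real.exp (-(c₁ * ℓ)) * Real.exp (-(c₂ * supDist (pos b) (pos b'))))
    (hA : ∀ b', |A' b'| ≤ a)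
    (hlarge : a * (N * (1 + 4 * dd / min (c₁ / 2) c₂) ^ dd) ≤ Real.exp (c₁ * ℓ / 4)) :
    Ineq576 ⟨Finset (Fin dd → ℤ), Finset.card⟩ (wbm w A' b m (assocZd pos ℓ b m))
      (min (c₁ / 4) (min (c₁ / 2) c₂ / (2 * dd))) ℓ := by
  have hc₃pos : 0 < min (c₁ / 2) c₂ := lt_min (by linarith) hc₂
  have hS := sum_exp_neg_supDist_fiber_le hd pos N hN (half_pos hc₃pos) b
  have hS' : ∑ b', Real.exp (-(min (c₁ / 2) c₂ / 2 * supDist (pos b) (pos b'))) ≤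
      N * (1 + 4 * dd / min (c₁ / 2) c₂) ^ dd := by
    have h4 : (1 + 2 * (dd : ℝ) / (min (c₁ / 2) c₂ / 2)) = 1 + 4 * dd / min (c₁ / 2) c₂ := by
      rw [div_div_eq_mul_div]; ring
    rw [← h4]
    exact hS
  exact ineq576_of_latticeSum hd pos hℓ w A' b hm hc₁ hc₂ hw hA hS' hlarge

/-- the bound with cube side `ℓ` gives (5.7.6) for every real `0 ≤ r(e_k) ≤ ℓ` (cubes of side `ℓ = ⌈r(e_k)⌉`): `Ineq576` is
monotone in `rk` for `c ≥ 0`. [cite: BalabanImbrieJaffe1988, (5.7.6) p.290] -/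
theorem ineq576_mono_rk (P : PolymerSys) (w : P.Poly → ℝ) {c rk rk' : ℝ} (hc : 0 ≤ c) (hrk : rk' ≤ rk)
    (h : Ineq576 P w c rk) : Ineq576 P w c rk' := by
  intro X
  refine (h X).trans (Real.exp_le_exp.mpr ?_)
  have : 0 ≤ c * (P.card X : ℝ) := mul_nonneg hc (Nat.cast_nonneg _)
  nlinarith

end Zd

end Literature.MathematicalPhysics.QuantumFieldTheory.BalabanImbrieJaffe1984to88.BIJ88Ineq576Proof
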